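import Mathlib
import Summits.QuantumAdvantage.QuantumAdvantage.Theorems.AbsorptionDialA
import Summits.QuantumAdvantage.AdviceFreeQNC0.WalkTubeRank
import Literature.Computability.MetaComplexity.HegedusLemma
import Literature.Computability.MetaComplexity.SmolenskyCorrelationRestrict
import HarnessLib

/-!
# ReadDial — the END-SHADOW LAW (Prop-definition-free twin of lens-4 g22 `Theses/ReadDial.lean` §1–§3 + polylog corollaries)

Supports item `stmt-QuantumAdvantage-28487` (`AbsorptionDial.NoPerfectPolyOdd`); nothing here closes or restates the item.

MAIN THEOREMS (every prime `p ≠ 3`, incl. `p = 2`):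
* `noPerfect_endReaders` — on `N = m + s + 2` bits, if the cuts at positions `< m` do not read the last two bits (otherwise
  ARBITRARY Boolean functions) and the `s + 3` cuts at positions `≥ m` have `𝔽_p`-degree `≤ d`, `3(s+3)d < p^ℓ`,
  `6p^ℓ ≤ m + 3`, then the strategy is not perfect in the u-walk ring game (`∃ u, ringWinU c y u = false`, every charge).
* `noPerfect_online` — no perfect strategy with lookahead `R` (cut `g` reads only bits `< g + R`) once `3(R+3)d < p^ℓ`,
  `6p^ℓ + R + 2 ≤ n`.
* `noPerfect_endOblivious_polylog`, `noPerfect_endObliviousWild_polylog`, `noPerfect_online_polylog` — the polylog-scale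
  forms (`p ≥ 5`, degree and lookahead `(log₂ n)^C`, all large `n`).
ENGINE: three-face shadow (blind cuts are live for exactly two of the faces `00, 01, 11` of the last two bits and cancel
mod 2; the end cuts see the free block only through `2|w| mod 3`) + exact Hegedűs on a weight class mod 3 (§1, the lever of
lens-4 g21 `LayerDial`, reproduced here because it is not yet a tree declaration) + the pointwise identity `J₀ ⊕ J₁ ⊕ J₂ = 0`.
0 sorry; axioms standard; no `instance`, no `notation`, no `native_decide`, no Prop definitions.
-/

set_option linter.dupNamespace false

noncomputable section

open Finset

namespace Summit.QuantumAdvantage.QuantumAdvantage.Theorems.ReadDial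

/-! ## §1  The lever (lens-4 g21 `LayerDial.lean` §1/§1b, not yet a tree declaration): EXACT AVOIDANCE — a polynomial of degree `< q = p^ℓ` (`p ≠ 3`) vanishing on every Hamming layer of one residue
class mod 3 vanishes identically once `6q ≤ n + 3` (two Hegedűs steps up, complement for the low layers). -/

section Lever

open Literature.Computability.MetaComplexity Literature.Computability.MetaComplexity.Smolensky
open Literature.Computability.MetaComplexity.Hegedus

variable {F : Type*} [Field F] {n : ℕ}

/-- `|u| ≤ n`. -/
private theorem wt_le' (b : Fin n → Bool) : wt b ≤ n := by
  unfold wt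
  exact (Finset.card_le_univ _).trans (by simp)

/-- one Hegedűs step `k → k + q` in the shape we iterate. -/
theorem layer_step (p : ℕ) [Fact p.Prime] [CharP F p] {ℓ d k : ℕ} (hk : p ^ ℓ ≤ k + 1) (hd : d < p ^ ℓ)
    {P : CubeFn F n} (hP : P ∈ lowDeg F n d) (hvan : ∀ b : Fin n → Bool, wt b = k → P b = 0) :
    ∀ b : Fin n → Bool, wt b = k + p ^ ℓ → P b = 0 :=
  fun _ hb => eval_eq_zero_of_forall_wt_eq p hk hd hP hvan hb

/-- **High layers.** If `P` (degree `≤ d < q = p^ℓ`, `q ≢ 0 (mod 3)`) vanishes on every layer of weight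
`≡ a (mod 3)`, then `P` vanishes on every layer of weight `≥ 3q − 1`. -/
theorem vanish_high_of_vanish_mod3 (p : ℕ) [Fact p.Prime] [CharP F p] {ℓ d a : ℕ} (hq3 : p ^ ℓ % 3 ≠ 0)
    (hd : d < p ^ ℓ) {P : CubeFn F n} (hP : P ∈ lowDeg F n d)
    (hvan : ∀ u : Fin n → Bool, wt u % 3 = a % 3 → P u = 0) :
    ∀ u : Fin n → Bool, 3 * p ^ ℓ ≤ wt u + 1 → P u = 0 := by
  intro u hu
  set q := p ^ ℓ with hq
  have up1 : ∀ k, q ≤ k + 1 → k % 3 = a % 3 → ∀ b : Fin n → Bool, wt b = k + q → P b = 0 :=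
    fun k hk hka => layer_step p hk hd hP (fun b hb => hvan b (by rw [hb]; exact hka))
  have up2 : ∀ k, q ≤ k + 1 → k % 3 = a % 3 → ∀ b : Fin n → Bool, wt b = k + q + q → P b = 0 :=
    fun k hk hka => layer_step p (k := k + q) (by omega) hd hP (up1 k hk hka)
  have hq12 : q % 3 = 1 ∨ q % 3 = 2 := by omega
  set m := wt u with hm
  have h2q : 2 * q ≤ m + 1 := by omega
  rcases Nat.lt_or_ge (m % 3) 3 with _ | habs
  · by_cases h0 : m % 3 = a % 3
    · exact hvan u h0
    by_cases h1 : (m - q) % 3 = a % 3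
    · exact up1 (m - q) (by omega) h1 u (by omega)
    have h2 : (m - 2 * q) % 3 = a % 3 := by
      rcases hq12 with h | h <;> omega
    exact up2 (m - 2 * q) (by omega) h2 u (by omega)
  · exact absurd habs (by omega)

/-- **THE LEVER (exact avoidance).**  `p` prime, `q = p^ℓ ≢ 0 (mod 3)`, `d < q`, `6q ≤ n + 3`.  A polynomial function
`P : {0,1}ⁿ → F` (`char F = p`) of degree `≤ d` that vanishes on every Hamming layer of weight `≡ a (mod 3)` vanishes
IDENTICALLY (in print, tight: the immunity of `¬MOD_q` over `𝔽_p` [cite: BeckLi2013, Theorem 5.2]; the tree types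
Theorem 3.4, `beckLi2013_thm34`). -/
theorem eq_zero_of_vanish_mod3 (p : ℕ) [Fact p.Prime] [CharP F p] {ℓ d a : ℕ} (hq3 : p ^ ℓ % 3 ≠ 0)
    (hd : d < p ^ ℓ) (hn : 6 * p ^ ℓ ≤ n + 3) {P : CubeFn F n} (hP : P ∈ lowDeg F n d)
    (hvan : ∀ u : Fin n → Bool, wt u % 3 = a % 3 → P u = 0) :
    ∀ u : Fin n → Bool, P u = 0 := by
  intro u
  by_cases hhi : 3 * p ^ ℓ ≤ wt u + 1
  · exact vanish_high_of_vanish_mod3 p hq3 hd hP hvan u hhi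
  have hQ : cpl P ∈ lowDeg F n d := cpl_mem_lowDeg hP
  have hvanQ : ∀ v : Fin n → Bool, wt v % 3 = (n + 2 * a) % 3 → cpl P v = 0 := by
    intro v hv
    show P (fun i => !v i) = 0
    apply hvan
    have hle : wt v ≤ n := wt_le' v
    rw [wt_not]
    omega
  have hle : wt u ≤ n := wt_le' u
  have h := vanish_high_of_vanish_mod3 p hq3 hd hQ hvanQ (fun i => !u i) (by rw [wt_not]; omega)
  simpa [cpl] using h

/-- `p` prime, `p ≠ 3` ⟹ `p^ℓ ≢ 0 (mod 3)`. -/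
private theorem pow_mod_three_ne_zero {p : ℕ} (hp : p.Prime) (hp3 : p ≠ 3) (ℓ : ℕ) : p ^ ℓ % 3 ≠ 0 := by
  intro h
  have h3 : 3 ∣ p ^ ℓ := Nat.dvd_of_mod_eq_zero h
  have h3p : 3 ∣ p := Nat.Prime.dvd_of_dvd_pow Nat.prime_three h3
  exact hp3 ((Nat.prime_dvd_prime_iff_eq Nat.prime_three hp).1 h3p).symm

end Lever

section BoolLever

open Summit.QuantumAdvantage.AdviceFreeQNC0
open Literature.Computability.MetaComplexity Literature.Computability.MetaComplexity.Smolensky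

variable {n : ℕ}

/-- **EXACT AVOIDANCE for Boolean functions.** `p ≠ 3` prime, `d < p^ℓ`, `6p^ℓ ≤ n + 3`: a Boolean function of
`𝔽_p`-degree `≤ d` that is `false` on a whole weight class mod 3 is identically `false`. -/
theorem boolFalse_of_vanish_mod3 (p : ℕ) [hp : Fact p.Prime] (hp3 : p ≠ 3) {ℓ d a : ℕ} (hd : d < p ^ ℓ)
    (hn : 6 * p ^ ℓ ≤ n + 3) {f : (Fin n → Bool) → Bool} (hf : HasDegF p f d)
    (hvan : ∀ u : Fin n → Bool, wt u % 3 = a % 3 → f u = false) : ∀ u : Fin n → Bool, f u = false := by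
  have h := eq_zero_of_vanish_mod3 (F := ZMod p) p (a := a) (pow_mod_three_ne_zero hp.out hp3 ℓ) hd hn hf
    (fun u hu => by simp [hvan u hu])
  intro u
  have hu := h u
  by_contra hne
  rw [Bool.not_eq_false] at hne
  simp [hne] at hu

/-- the dual form: `true` on a whole weight class mod 3 ⟹ identically `true`. -/
theorem boolTrue_of_true_mod3 (p : ℕ) [hp : Fact p.Prime] (hp3 : p ≠ 3) {ℓ d a : ℕ} (hd : d < p ^ ℓ)
    (hn : 6 * p ^ ℓ ≤ n + 3) {f : (Fin n → Bool) → Bool} (hf : HasDegF p f d)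
    (htrue : ∀ u : Fin n → Bool, wt u % 3 = a % 3 → f u = true) : ∀ u : Fin n → Bool, f u = true := by
  have hnot : HasDegF p (fun u => !f u) d := RegisterRotation.hasDegF_not hf
  have h := boolFalse_of_vanish_mod3 p hp3 (a := a) hd hn hnot (fun u hu => by simp [htrue u hu])
  intro u
  simpa using h u

end BoolLever

/-! ## §2  Reads, the end-peeled point `w ++ 0^s ++ f`, the three faces -/

section EndShadow

open Summit.QuantumAdvantage.AdviceFreeQNC0
open Literature.Computability.MetaComplexity Literature.Computability.MetaComplexity.Smolensky
open Summit.QuantumAdvantage.QuantumAdvantage.Theorems.AbsorptionDial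

variable {N : ℕ}

variable {m s : ℕ}

/-- the end-peeled point `w ++ 0^s ++ f`: free block `w` (length `m`), frozen strip `0^s`, the last two bits `f`. -/
def pt (m s : ℕ) (w : Fin m → Bool) (f : Fin 2 → Bool) : Fin (m + s + 2) → Bool :=
  Fin.append (Fin.append w (fun _ : Fin s => false)) f

/-- the three FACES `00, 01, 11` of the last two bits: weights `0, 1, 2`. -/
def face : Fin 3 → Fin 2 → Bool := ![![false, false], ![false, true], ![true, true]]

/-- ReadDialEndShadowA helper `wt_face` (decomp-qadv land package; see the module docstring). -/
theorem wt_face (j : Fin 3) : wt (face j) = j.val := by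
  fin_cases j <;> decide

/-- ReadDialEndShadowA helper `wt_falseFun` (decomp-qadv land package; see the module docstring). -/
private theorem wt_falseFun : wt (fun _ : Fin s => false) = 0 := by
  unfold wt; simp

/-- ReadDialEndShadowA helper `wtPrefix_falseFun` (decomp-qadv land package; see the module docstring). -/
private theorem wtPrefix_falseFun (k : ℕ) : wtPrefix (fun _ : Fin s => false) k = 0 := by
  unfold wtPrefix; simp

/-- ReadDialEndShadowA helper `wtPrefix_zero` (decomp-qadv land package; see the module docstring). -/
private theorem wtPrefix_zero {k : ℕ} (f : Fin k → Bool) : wtPrefix f 0 = 0 := by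
  unfold wtPrefix; simp

/-- ReadDialEndShadowA helper `wt_pt` (decomp-qadv land package; see the module docstring). -/
theorem wt_pt (w : Fin m → Bool) (f : Fin 2 → Bool) : wt (pt m s w f) = wt w + wt f := by
  unfold pt; rw [wt_append, wt_append, wt_falseFun]; ring

/-- ReadDialEndShadowA helper `wtPrefix_pt_le` (decomp-qadv land package; see the module docstring). -/
theorem wtPrefix_pt_le (w : Fin m → Bool) (f : Fin 2 → Bool) {g : ℕ} (hg : g ≤ m) :
    wtPrefix (pt m s w f) g = wtPrefix w g := by
  unfold pt
  rw [wtPrefix_append_of_le _ _ (by omega : g ≤ m + s), wtPrefix_append_of_le _ _ hg]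

/-- ReadDialEndShadowA helper `wtPrefix_pt_ge` (decomp-qadv land package; see the module docstring). -/
theorem wtPrefix_pt_ge (w : Fin m → Bool) (f : Fin 2 → Bool) {g : ℕ} (hg : m ≤ g) :
    wtPrefix (pt m s w f) g = wt w + wtPrefix f (g - (m + s)) := by
  unfold pt
  by_cases h : m + s ≤ g
  · rw [wtPrefix_append_of_ge _ _ h, wt_append, wt_falseFun, Nat.add_zero]
  · rw [wtPrefix_append_of_le _ _ (by omega : g ≤ m + s), wtPrefix_append_of_ge _ _ hg, wtPrefix_falseFun,
      Nat.sub_eq_zero_of_le (by omega : g ≤ m + s), wtPrefix_zero]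

/-- a cut LEFT of the free block's end sees the faces only through `|f|`. -/
theorem walkExp_pt_le (w : Fin m → Bool) (f : Fin 2 → Bool) {g : ℕ} (hg : g ≤ m) :
    walkExp (pt m s w f) g = wt w + wtPrefix w g + wt f := by
  unfold walkExp; rw [wt_pt, wtPrefix_pt_le w f hg]; ring

/-- a cut RIGHT of the free block sees the free block only through `2·|w|`. -/
theorem walkExp_pt_ge (w : Fin m → Bool) (f : Fin 2 → Bool) {g : ℕ} (hg : m ≤ g) :
    walkExp (pt m s w f) g = 2 * wt w + (wt f + wtPrefix f (g - (m + s))) := by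
  unfold walkExp; rw [wt_pt, wtPrefix_pt_ge w f hg]; ring

/-- two end-peeled points with different faces agree below `m + s`. -/
theorem pt_congr (w : Fin m → Bool) (f f' : Fin 2 → Bool) (i : Fin (m + s + 2)) (hi : i.val < m + s) :
    pt m s w f i = pt m s w f' i := by
  have : i = Fin.castAdd 2 ⟨i.val, hi⟩ := Fin.ext rfl
  unfold pt
  rw [this, Fin.append_left, Fin.append_left]

/-- restriction to the free block keeps the `𝔽_p`-degree. -/
theorem hasDegF_pt {p : ℕ} [Fact p.Prime] {d : ℕ} {y : (Fin (m + s + 2) → Bool) → Bool} (hy : HasDegF p y d)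
    (f : Fin 2 → Bool) : HasDegF p (fun w : Fin m → Bool => y (pt m s w f)) d := by
  unfold HasDegF at *
  have h1 := comp_append_mem_lowDeg hy f
  exact comp_append_mem_lowDeg h1 (fun _ : Fin s => false)

end EndShadow


end Summit.QuantumAdvantage.QuantumAdvantage.Theorems.ReadDial
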